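import Mathlib
import Summits.PneNP.PneNP.Theses.AeaCutRectangles
import Summits.PneNP.PneNP.Theorems.AeaCutRectanglesDutyRectangles
import Summits.PneNP.PneNP.Theorems.AeaCutRectanglesSwapBookends

/-!
# Ideas round 2, seat 1, gen 9 — `stmt-PneNP-19727` `FoolingMeasure` (X1)

FRONTIER restricted-model rung (AEA / cut rectangles).  Nothing here bears on `P ≠ NP`.

First lemmas for three crux idea cards:

* §1 `wrap-repair-sites` — `no_local_repair` (PROVED): if a colouring `r` is proper on every edge of a
  non-3-colourable `S` except one edge `e₀`, and `D ⊇ e₀` is a vertex set all of whose incident `S`-edges lie in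
  the hybrid `H`, then NO proper 3-colouring of `H` agrees with `r` off `D`.  (Rigidity: the residue colouring of a
  ruler of a normal system cannot be repaired inside the member's own ball around its wrap edge; so frame-sector rows
  — wrap balls inside Alice's territory — are "self-covered" at every radius, and the frame-sector rectangle forces
  the residual colourability to carry X1.)
* §2 `compatibility-thinning` — `fibreCore`, `rect_sum_le_sum_fibreCore` (PROVED): the mass of a valid cut rectangle
  is at most the sum over its columns `β` of the mass of the β-fibre members compatible with EVERY column; plus the
  typed hypotheses `GeometricThinning`, `FibreLight` and the conditional target `ThinningReduction`.
* §3 `portal-slices` — `recombine`, `recombine_injective` (PROVED): successor maps of two Hamiltonian rulers with the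
  same crossing pairs at the cut recombine (Bob's steps from one, Alice's from the other) into a permutation; the
  typed statement `RecombinationClosed` (single cycle + normality under equal portal skeletons = Lemma A of the card).
-/

set_option linter.dupNamespace false

namespace Summit.PneNP.PneNP.Cruxes.FoolingMeasure.IdeasR2g9s1

open Finset
open Summit.PneNP.PneNP.Theorems.AeaCutRectanglesDutyRectangles (aliceSide bobSide mem_aliceSide mem_bobSide
  aliceSide_union_bobSide)
open Summit.PneNP.PneNP.Theorems.AeaCutRectanglesSwapBookends (aliceSide_union_eq bobSide_union_eq)
open Summit.PneNP.PneNP.Theorems.AeaCutRectanglesTransversalEngine (parts_unique)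

/-- 3-colourability of the graph spanned by an edge set over `Fin n` (as in the route file). -/
abbrev Col3 {n : ℕ} (G : Finset (Sym2 (Fin n))) : Prop :=
  (SimpleGraph.fromEdgeSet (G : Set (Sym2 (Fin n)))).Colorable 3

/-! ## §1  Rigidity: no local repair of an almost-proper colouring inside the member's own ball -/

section rigidity

variable {n : ℕ}

/-- **No local repair.**  `S` non-3-colourable, `r` proper on every edge of `S` other than `e₀`, `D` a vertex set
containing `e₀`'s endpoints such that every `S`-edge touching `D` belongs to `H`.  Then no proper 3-colouring of
`H` coincides with `r` outside `D`.  (Applied with `r` = residue colouring of ruler `k`, `e₀` = its wrap edge,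
`D` = radius-`ρ` ball of `e₀` in `S` lying inside `V ∖ B`, `H ⊇ aliceSide B S`.) -/
theorem no_local_repair (S H : Finset (Sym2 (Fin n))) (r : Fin n → Fin 3) (e₀ : Sym2 (Fin n)) (D : Finset (Fin n))
    (hS : ¬ Col3 S)
    (hr : ∀ u v : Fin n, s(u, v) ∈ S → s(u, v) ≠ e₀ → u ≠ v → r u ≠ r v)
    (he₀ : ∀ v ∈ e₀, v ∈ D)
    (hD : ∀ e ∈ S, (∃ v ∈ e, v ∈ D) → e ∈ H)
    (c : (SimpleGraph.fromEdgeSet (H : Set (Sym2 (Fin n)))).Coloring (Fin 3))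
    (hc : ∀ v, v ∉ D → c v = r v) : False := by
  apply hS
  refine ⟨SimpleGraph.Coloring.mk (fun v => c v) ?_⟩
  intro u v hadj
  rw [SimpleGraph.fromEdgeSet_adj] at hadj
  obtain ⟨hmem, huv⟩ := hadj
  have hmem' : s(u, v) ∈ S := hmem
  by_cases hD' : u ∈ D ∨ v ∈ D
  · -- the edge touches `D`, hence lies in `H`, where `c` is proper
    have hH : s(u, v) ∈ H := hD _ hmem' (by
      rcases hD' with h | h
      · exact ⟨u, Sym2.mem_mk_left u v, h⟩
      · exact ⟨v, Sym2.mem_mk_right u v, h⟩)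
    exact c.valid (by rw [SimpleGraph.fromEdgeSet_adj]; exact ⟨hH, huv⟩)
  · push Not at hD'
    have hne : s(u, v) ≠ e₀ := by
      intro h
      exact hD'.1 (he₀ u (h ▸ Sym2.mem_mk_left u v))
    have := hr u v hmem' hne huv
    simp only [ne_eq]
    rw [hc u hD'.1, hc v hD'.2]
    exact this

end rigidity

/-! ## §2  Fibre cores and the fibre-sum inequality -/

section fibre

variable {n : ℕ}

open Classical in
/-- the **core of the β-fibre** relative to a column population `𝓑`: members `G` whose Bob side at `B` is `β`
and whose Alice side is compatible (union not 3-colourable) with EVERY column of `𝓑`. -/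
noncomputable def fibreCore (B : Finset (Fin n)) (𝓑 : Finset (Finset (Sym2 (Fin n)))) (β : Finset (Sym2 (Fin n))) :
    Finset (Finset (Sym2 (Fin n))) :=
  univ.filter fun G => bobSide B G = β ∧ ∀ β' ∈ 𝓑, ¬ Col3 (aliceSide B G ∪ β')

/-- **Fibre-sum inequality** (the starting point of compatibility thinning): for `μ ≥ 0` and a valid cut rectangle
`𝓐 ⊗ 𝓑` over `B`, the rectangle mass is at most `∑_{β ∈ 𝓑} μ(fibreCore B 𝓑 β)`. -/
theorem rect_sum_le_sum_fibreCore (μ : Finset (Sym2 (Fin n)) → ℝ) (hμ : ∀ S, 0 ≤ μ S) (B : Finset (Fin n))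
    (𝓐 𝓑 : Finset (Finset (Sym2 (Fin n))))
    (h𝓐 : ∀ α ∈ 𝓐, ∀ e ∈ α, ¬ e.IsDiag ∧ ∃ v ∈ e, v ∉ B)
    (h𝓑 : ∀ β ∈ 𝓑, ∀ e ∈ β, ¬ e.IsDiag ∧ ∀ v ∈ e, v ∈ B)
    (hN : ∀ α ∈ 𝓐, ∀ β ∈ 𝓑, ¬ Col3 (α ∪ β)) :
    ∑ q ∈ 𝓐 ×ˢ 𝓑, μ (q.1 ∪ q.2) ≤ ∑ β ∈ 𝓑, ∑ G ∈ fibreCore B 𝓑 β, μ G := by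
  classical
  rw [sum_product_right]
  refine sum_le_sum fun β hβ => ?_
  -- `α ↦ α ∪ β` is injective on `𝓐` and lands in the core of the β-fibre
  have hinj : ∀ α ∈ 𝓐, ∀ α' ∈ 𝓐, α ∪ β = α' ∪ β → α = α' := by
    intro α hα α' hα' h
    exact (parts_unique h (fun e he => (h𝓐 _ hα e he).2) (fun e he => (h𝓐 _ hα' e he).2)
      (fun e he => (h𝓑 _ hβ e he).2) (fun e he => (h𝓑 _ hβ e he).2)).1
  have : ∑ α ∈ 𝓐, μ (α ∪ β) = ∑ G ∈ 𝓐.image (fun α => α ∪ β), μ G := (sum_image hinj).symm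
  rw [this]
  refine sum_le_sum_of_subset_of_nonneg (fun G hG => ?_) fun G _ _ => hμ G
  obtain ⟨α, hα, rfl⟩ := mem_image.1 hG
  have hαs : ∀ e ∈ α, ∃ v ∈ e, v ∉ B := fun e he => (h𝓐 _ hα e he).2
  have hβs : ∀ e ∈ β, ∀ v ∈ e, v ∈ B := fun e he => (h𝓑 _ hβ e he).2
  simp only [fibreCore, mem_filter, mem_univ, true_and]
  refine ⟨bobSide_union_eq hαs hβs, fun β' hβ' => ?_⟩
  rw [aliceSide_union_eq hαs hβs]
  exact hN α hα β' hβ'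

open Classical in
/-- mass of a finite family under `μ`. -/
noncomputable def mass (μ : Finset (Sym2 (Fin n)) → ℝ) (𝓕 : Finset (Finset (Sym2 (Fin n)))) : ℝ := ∑ G ∈ 𝓕, μ G

open Classical in
/-- **Geometric thinning at rate `θ` and separation `d`** for `μ` at the cut `B` (the card's hypothesis TH):
whenever `β₀, β₁, …, β_k` are columns that are pairwise `d`-far in symmetric difference, the part of the `β₀`-fibre
compatible with all of `β₁ … β_k` has mass at most `θ ^ k` times the `β₀`-fibre.  (Informal target rate for normal
`t`-systems: any `1 - θ ≥ n ^ (-ε n / 2)` suffices together with `FibreLight`.) -/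
def GeometricThinning (μ : Finset (Sym2 (Fin n)) → ℝ) (B : Finset (Fin n)) (θ : ℝ) (d : ℕ) : Prop :=
  ∀ β₀ : Finset (Sym2 (Fin n)), ∀ 𝓑 : Finset (Finset (Sym2 (Fin n))),
    (∀ β ∈ 𝓑, ∀ e ∈ β, ¬ e.IsDiag ∧ ∀ v ∈ e, v ∈ B) →
    (∀ β ∈ 𝓑, ∀ β' ∈ 𝓑, β ≠ β' → d ≤ (symmDiff β β').card) → (∀ β ∈ 𝓑, d ≤ (symmDiff β β₀).card) →
    mass μ (fibreCore B 𝓑 β₀) ≤ θ ^ 𝓑.card * mass μ (univ.filter fun G => bobSide B G = β₀)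

open Classical in
/-- **Fibre lightness** with exponent bonus `η`: every Bob fibre at a balanced cut has mass at most
`2 ^ (-(1/2 + η) n log₂ n)` (v7.1 support clause of the normal-cycle-systems card, LD speed `(t/4) n log n`). -/
def FibreLight (μ : Finset (Sym2 (Fin n)) → ℝ) (B : Finset (Fin n)) (η : ℝ) : Prop :=
  ∀ β : Finset (Sym2 (Fin n)),
    mass μ (univ.filter fun G => bobSide B G = β) ≤ (2 : ℝ) ^ (-((1 / 2 + η) * (n : ℝ) * Real.logb 2 n))

/-- **Thinning reduction** (conditional target of the card, to be proved by a covering/packing argument in the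
column metric): geometric thinning at a rate `1 - θ ≥ 2^{-(η/2) n log₂ n}` with separation `d ≤ n / log₂ n`, plus
fibre lightness with bonus `η`, give X1's rectangle clause at `B` with room to spare. -/
def ThinningReduction : Prop :=
  ∀ (n : ℕ) (μ : Finset (Sym2 (Fin n)) → ℝ) (B : Finset (Fin n)) (θ η : ℝ) (d : ℕ) (C : ℝ),
    (∀ S, 0 ≤ μ S) → 0 < η → (d : ℝ) * Real.logb 2 n ≤ n →
    1 - θ ≥ (2 : ℝ) ^ (-(η / 2) * (n : ℝ) * Real.logb 2 n) →
    GeometricThinning μ B θ d → FibreLight μ B η → (64 : ℝ) * (C + 1) ≤ η * Real.logb 2 n →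
    ∀ 𝓐 𝓑 : Finset (Finset (Sym2 (Fin n))),
      (∀ α ∈ 𝓐, ∀ e ∈ α, ¬ e.IsDiag ∧ ∃ v ∈ e, v ∉ B) →
      (∀ β ∈ 𝓑, ∀ e ∈ β, ¬ e.IsDiag ∧ ∀ v ∈ e, v ∈ B) →
      (∀ α ∈ 𝓐, ∀ β ∈ 𝓑, ¬ Col3 (α ∪ β)) →
      ∑ q ∈ 𝓐 ×ˢ 𝓑, μ (q.1 ∪ q.2) ≤ (2 : ℝ) ^ (-((n : ℝ) / 2 * Real.logb 2 n) - C * n)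

end fibre

/-! ## §3  Portal recombination -/

section portal

variable {n : ℕ}

/-- **Recombination** of two successor maps at the cut `B`: Bob's steps (from vertices of `B`) are taken from `g`,
Alice's steps (from vertices outside `B`) from `f`. -/
def recombine (B : Finset (Fin n)) (f g : Fin n → Fin n) : Fin n → Fin n :=
  fun v => if v ∈ B then g v else f v

/-- If `f`, `g` are injective and have the SAME CROSSING PAIRS at `B` (the zeroth layer of the portal skeleton:
`(v, f v)` crosses the cut iff `(v, g v)` does, and then `f v = g v`), the recombination is injective — hence a
permutation of `Fin n`.  (Lemma A of the card adds: equal run/gap matchings ⇒ a single Hamiltonian cycle; equal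
run lengths and wrap positions ⇒ same frame; normality ⇔ the order demands.) -/
theorem recombine_injective (B : Finset (Fin n)) (f g : Fin n → Fin n) (hf : Function.Injective f)
    (hg : Function.Injective g)
    (hcross : ∀ v, (v ∈ B ↔ f v ∉ B) → f v = g v)
    (hcross' : ∀ v, (v ∈ B ↔ g v ∉ B) → f v = g v) :
    Function.Injective (recombine B f g) := by
  intro u v huv
  simp only [recombine] at huv
  by_cases hu : u ∈ B <;> by_cases hv : v ∈ B <;> simp only [hu, hv, if_true, if_false] at huv
  · exact hg huv
  · -- `g u = f v` with `u ∈ B`, `v ∉ B`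
    by_cases hgu : g u ∈ B
    · -- then `(v, f v)` enters `B`: a crossing pair of `f`, so `f v = g v`, contradicting injectivity of `g`
      have hfv : f v ∈ B := huv ▸ hgu
      have h1 : f v = g v := hcross v ⟨fun h => absurd h hv, fun h => absurd hfv h⟩
      have : u = v := hg (huv.trans h1)
      exact absurd (this ▸ hu) hv
    · -- `(u, g u)` exits `B`: a crossing pair of `g`, so `f u = g u = f v`
      have h1 : f u = g u := hcross' u ⟨fun _ => hgu, fun _ => hu⟩
      exact hf (h1.trans huv)
  · by_cases hgv : g v ∈ B
    · have hfu : f u ∈ B := huv ▸ hgv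
      have h1 : f u = g u := hcross u ⟨fun h => absurd h hu, fun h => absurd hfu h⟩
      have : v = u := hg (huv.symm.trans h1)
      exact absurd (this ▸ hv) hu
    · have h1 : f v = g v := hcross' v ⟨fun _ => hgv, fun _ => hv⟩
      exact hf (huv.trans h1.symm)
  · exact hf huv

/-- a successor map is a Hamiltonian ruler: a permutation consisting of one `n`-cycle. -/
def IsHamiltonian (f : Fin n → Fin n) : Prop :=
  Function.Bijective f ∧ ∀ u v : Fin n, ∃ m : ℕ, f^[m] u = v

/-- exit point of the `B`-run through `v`: iterate `f` from `v` while staying in `B` (as a relation, to avoid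
choosing a recursion principle here): `w` is the exit of `v` iff `w = f^[m] v` with `f^[i] v ∈ B` for `i ≤ m` and
`f^[m+1] v ∉ B`. -/
def IsExitOf (B : Finset (Fin n)) (f : Fin n → Fin n) (v w : Fin n) : Prop :=
  ∃ m : ℕ, f^[m] v = w ∧ (∀ i ≤ m, f^[i] v ∈ B) ∧ f^[m + 1] v ∉ B

/-- **Recombination closure (Lemma A of `portal-slices`, zeroth + first layer)**: two Hamiltonian rulers with the
same crossing pairs at `B` AND the same run matchings (every entry point has the same exit point under `f` and
under `g`, on both sides of the cut) recombine into a Hamiltonian ruler. -/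
def RecombinationClosed : Prop :=
  ∀ (n : ℕ) (B : Finset (Fin n)) (f g : Fin n → Fin n), IsHamiltonian f → IsHamiltonian g →
    (∀ v, (v ∈ B ↔ f v ∉ B) → f v = g v) → (∀ v, (v ∈ B ↔ g v ∉ B) → f v = g v) →
    (∀ v w, IsExitOf B f v w ↔ IsExitOf B g v w) → (∀ v w, IsExitOf Bᶜ f v w ↔ IsExitOf Bᶜ g v w) →
    IsHamiltonian (recombine B f g)

end portal

end Summit.PneNP.PneNP.Cruxes.FoolingMeasure.IdeasR2g9s1
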